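import Mathlib.RingTheory.Nullstellensatz
import Mathlib.Algebra.MvPolynomial.Funext
import Mathlib.Analysis.Complex.Polynomial.Basic
import Mathlib.Analysis.Normed.Module.Connected
import Mathlib.LinearAlgebra.Complex.FiniteDimensional
import Mathlib.Topology.Algebra.MvPolynomial
import HarnessLib

/-!
# Connectedness of irreducible affine varieties over `ℂ` in the classical topology

The named fact of this file is the affine, coordinate form of the theorem
«If `X` is an irreducible algebraic variety over `ℂ`, then `X(ℂ)` is connected»
(Shafarevich, *Basic Algebraic Geometry 2*, Book 3, Ch. VII §2, Theorem 7.1; equivalently the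
irreducible case of SGA1 XII Prop. 2.4, «`X` irréductible ⇒ `X^an` connexe»):

* `Literature.NumberTheory.Transcendental.isConnected_zeroLocus_of_isPrime`: for a prime ideal `𝔭 ⊆ ℂ[x₁, …, xₙ]`, the zero set
  `V(𝔭) = MvPolynomial.zeroLocus ℂ 𝔭 ⊆ ℂⁿ` is connected for the classical (product) topology
  of `ℂⁿ = Fin n → ℂ`.

An irreducible affine variety over `ℂ` is `V(𝔭)` for a prime `𝔭` and its set of complex points
with the analytic topology is the subspace `V(𝔭) ⊆ ℂⁿ` (Serre, GAGA §2 n°5 Lemme 1); the reduction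
of the general statement (any scheme locally of finite type over `ℂ`, any irreducible closed
subset) to this coordinate form is carried out in
`Literature/NumberTheory/Transcendental/AnalytificationConnectedAffine.lean`, and the reduction
of SGA1 XII Prop. 2.4 (`X` connected ⇔ `X(ℂ)` connected) to the irreducible case in
`Literature/NumberTheory/Transcendental/AnalytificationConnected.lean`.

The fact is **discharged** in the sibling files `PolynomialOnLines.lean`, `HypersurfaceCover.lean`
and `ZeroLocusConnectedProofs.lean` (`Literature.NumberTheory.Transcendental.isConnected_zeroLocus_of_isPrime_holds`), by
Shafarevich's *second proof* (VII §2.3–2.4) with the density theorem of Mumford,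
*Algebraic Geometry I: Complex Projective Varieties*, (2.33) / SGA1 XII Prop. 2.2 (taken from
`AnalytificationProperProofs.lean`) replacing Lemma 7.1: Noether normalisation
`ℂ[z₁, …, z_r] ⊆ ℂ[V]` (Mathlib) and a primitive element `θ` give a hypersurface model
`F(z, θ) = 0`; over the complement of a hypersurface `S ⊆ ℂʳ` (connected, Lemma 7.2) the model is
an unramified cover whose sheets over a clopen piece have elementary symmetric functions that are
entire of polynomial growth along every complex line (implicit function theorem, Riemann's
removable singularity theorem, Lemma 7.6), hence polynomials, which factors the minimal
polynomial of `θ` — a contradiction; finally every point of `V` is a limit of points of the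
cover. This file keeps the statement, its unconditional nonemptiness half, and the preliminary
Lemma 7.2 (principal-open case; the printed form is `Literature.NumberTheory.Transcendental.isConnected_compl_zeroLocus` of
`ZeroLocusConnectedProofs.lean`).

## References

* I. R. Shafarevich, *Basic Algebraic Geometry 2*, Springer 1994, Book 3, Ch. VII §2, Thm. 7.1,
  Lemmas 7.1, 7.2, 7.5, 7.6 and the Lemma of §2.3.
* A. Grothendieck, M. Raynaud, *SGA 1*, Exp. XII, Prop. 2.4.
* D. Mumford, *Algebraic Geometry I: Complex Projective Varieties*, Springer 1976, (2.33), (4.16).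
* J.-P. Serre, *Géométrie algébrique et géométrie analytique*, Ann. Inst. Fourier **6** (1956),
  §2 n°5.
-/

noncomputable section

open MvPolynomial

namespace Literature.NumberTheory.Transcendental

/-- **Irreducible affine varieties over `ℂ` are connected in the classical topology**
(Shafarevich's Theorem 7.1, affine case; the irreducible case of SGA1 XII Prop. 2.4, in
coordinates). For every `n` and every prime ideal `𝔭` of `ℂ[x₁, …, xₙ]`, the common zero set
`V(𝔭) = {z ∈ ℂⁿ | ∀ p ∈ 𝔭, p(z) = 0}` (Mathlib `MvPolynomial.zeroLocus ℂ 𝔭`) is a connected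
subset of `ℂⁿ` for its usual topology (in particular nonempty, which is the weak
Nullstellensatz, `zeroLocus_nonempty_of_ne_top`). Primality cannot be weakened to `V(𝔭)`
irreducible-as-a-set only in the sense that this is the same condition (`V(𝔭) = V(√𝔭)`); it
cannot be dropped (`V(x(x-1)) ⊆ ℂ` is two points).
[cite: Shafarevich1994, Book 3 Ch. VII §2 Thm. 7.1] [cite: SGA1, Exp. XII Prop. 2.4 (cas irréductible)] -/
def isConnected_zeroLocus_of_isPrime : Prop :=
  ∀ ⦃n : ℕ⦄ (𝔭 : Ideal (MvPolynomial (Fin n) ℂ)), 𝔭.IsPrime →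
    IsConnected (zeroLocus ℂ 𝔭 : Set (Fin n → ℂ))

/-- The weak Nullstellensatz in the form used here: a proper ideal of `ℂ[x₁, …, xₙ]` has a common
zero (Mathlib `MvPolynomial.vanishingIdeal_zeroLocus_eq_radical`). [Shafarevich, *Basic Algebraic
Geometry 1*, Ch. I §2; Atiyah–Macdonald Ch. 7 Ex. 14] [folklore] -/
theorem zeroLocus_nonempty_of_ne_top {n : ℕ} {I : Ideal (MvPolynomial (Fin n) ℂ)}
    (hI : I ≠ ⊤) : (zeroLocus ℂ I : Set (Fin n → ℂ)).Nonempty := by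
  by_contra h
  rw [Set.not_nonempty_iff_eq_empty] at h
  have hrad : I.radical = ⊤ := by
    rw [← vanishingIdeal_zeroLocus_eq_radical (K := ℂ) I, h]
    exact vanishingIdeal_empty
  exact hI (Ideal.radical_eq_top.mp hrad)

/-- In particular `V(𝔭) ≠ ∅` for a prime `𝔭` (the nonemptiness half of
`isConnected_zeroLocus_of_isPrime`, which holds unconditionally). [folklore] -/
theorem zeroLocus_nonempty_of_isPrime {n : ℕ} (𝔭 : Ideal (MvPolynomial (Fin n) ℂ))
    [h𝔭 : 𝔭.IsPrime] : (zeroLocus ℂ 𝔭 : Set (Fin n → ℂ)).Nonempty :=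
  zeroLocus_nonempty_of_ne_top h𝔭.ne_top

/-- `V(𝔭)` is closed in `ℂⁿ` (polynomials are continuous). [folklore] -/
theorem isClosed_zeroLocus {n : ℕ} (I : Ideal (MvPolynomial (Fin n) ℂ)) :
    IsClosed (zeroLocus ℂ I : Set (Fin n → ℂ)) := by
  have : (zeroLocus ℂ I : Set (Fin n → ℂ)) = ⋂ p ∈ I, (fun z ↦ aeval z p) ⁻¹' {0} := by
    ext z
    simp [mem_zeroLocus_iff]
  rw [this]
  refine isClosed_biInter fun p _ ↦ IsClosed.preimage ?_ isClosed_singleton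
  simp_rw [aeval_eq_eval]
  exact MvPolynomial.continuous_eval p


/-! ### Preliminary lemmas (Shafarevich VII §2.1): polynomials on open sets, Lemma 7.2 -/

/-- A polynomial vanishing on a nonempty open subset of `ℂⁿ` is zero (an open set contains a box
with infinite sides; Mathlib `MvPolynomial.funext_set`). [Shafarevich1994 VII §2.1, proof of
Lemma 7.2; Mumford CPV (2.33) Step I] [folklore] -/
theorem eq_zero_of_forall_eval_eq_zero_of_isOpen {n : ℕ} {p : MvPolynomial (Fin n) ℂ}
    {W : Set (Fin n → ℂ)} (hW : IsOpen W) (hW' : W.Nonempty) (h : ∀ z ∈ W, eval z p = 0) :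
    p = 0 := by
  obtain ⟨z₀, hz₀⟩ := hW'
  obtain ⟨u, hu, huW⟩ := (isOpen_pi_iff'.mp hW) z₀ hz₀
  have hinf : ∀ i, (u i).Infinite := fun i ↦
    infinite_of_mem_nhds (z₀ i) ((hu i).1.mem_nhds (hu i).2)
  refine funext_set u hinf fun z hz ↦ ?_
  rw [h z (huW hz), map_zero]

/-- The complement of a proper algebraic hypersurface `Z(g) ⊆ ℂⁿ` (`g ≠ 0`) is dense.
[Shafarevich1994 VII §2.1; Mumford CPV (2.33) Step I] [folklore] -/
theorem dense_setOf_eval_ne_zero {n : ℕ} {g : MvPolynomial (Fin n) ℂ} (hg : g ≠ 0) :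
    Dense {z : Fin n → ℂ | eval z g ≠ 0} := by
  rw [dense_iff_inter_open]
  intro O hO hO'
  by_contra hc
  rw [Set.not_nonempty_iff_eq_empty] at hc
  refine hg (eq_zero_of_forall_eval_eq_zero_of_isOpen hO hO' fun z hz ↦ ?_)
  by_contra hz'
  have : z ∈ O ∩ {z : Fin n → ℂ | eval z g ≠ 0} := ⟨hz, hz'⟩
  rw [hc] at this
  exact this

/-- A nonzero polynomial has a non-zero value somewhere on `ℂⁿ`. [folklore] -/
theorem exists_eval_ne_zero {n : ℕ} {g : MvPolynomial (Fin n) ℂ} (hg : g ≠ 0) :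
    ∃ z : Fin n → ℂ, eval z g ≠ 0 := by
  by_contra h
  simp only [not_exists, not_not] at h
  exact hg (MvPolynomial.funext fun z ↦ by rw [h z, map_zero])

/-- Restriction of a polynomial on `ℂⁿ` to the complex line `s ↦ a + s • (b - a)` through `a`
and `b`: a one-variable polynomial `q` with `q(s) = g(a + s(b - a))`. [Shafarevich1994 VII §2.1,
proof of Lemma 7.2] [folklore] -/
theorem exists_polynomial_eval_lineMap {n : ℕ} (g : MvPolynomial (Fin n) ℂ) (a b : Fin n → ℂ) :
    ∃ q : Polynomial ℂ, ∀ s : ℂ, q.eval s = eval (a + s • (b - a)) g := by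
  refine ⟨aeval (fun i ↦ Polynomial.C (a i) + Polynomial.X * Polynomial.C (b i - a i)) g,
    fun s ↦ ?_⟩
  have key := congrArg (fun φ ↦ φ g) (MvPolynomial.comp_aeval (R := ℂ)
    (fun i ↦ Polynomial.C (a i) + Polynomial.X * Polynomial.C (b i - a i)) (Polynomial.aeval s))
  simp only [AlgHom.coe_comp, Function.comp_apply, Polynomial.coe_aeval_eq_eval, map_add,
    Polynomial.eval_C, map_mul, Polynomial.eval_X] at key
  rw [key]
  change _ = eval _ g
  rw [show (fun i ↦ a i + s * (b i - a i)) = a + s • (b - a) from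
    funext fun i ↦ by simp [Pi.add_apply, Pi.smul_apply, Pi.sub_apply, smul_eq_mul]]
  rfl

/-- **Shafarevich's Lemma 7.2**, the case of a principal open set (to which the printed statement
«`V ⊂ 𝔸ⁿ` Zariski open ⇒ `V(ℂ)` connected» reduces: `Literature.NumberTheory.Transcendental.isConnected_compl_zeroLocus`): the
complement `ℂⁿ ∖ Z(g)` of an algebraic hypersurface, `g ≠ 0`, is path connected — two points are
joined inside the complex line through them, which meets `Z(g)` in finitely many points, and `ℂ`
minus finitely many points is path connected.
[Shafarevich1994 VII §2.1 Lemma 7.2, special case] [folklore] -/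
theorem isPathConnected_setOf_eval_ne_zero {n : ℕ} {g : MvPolynomial (Fin n) ℂ} (hg : g ≠ 0) :
    IsPathConnected {z : Fin n → ℂ | eval z g ≠ 0} := by
  rw [isPathConnected_iff]
  refine ⟨exists_eval_ne_zero hg, fun a ha b hb ↦ ?_⟩
  obtain ⟨q, hq⟩ := exists_polynomial_eval_lineMap g a b
  -- the line and the finitely many parameters where it meets `Z(g)`
  let ℓ : ℂ → (Fin n → ℂ) := fun s ↦ a + s • (b - a)
  have hℓ : Continuous ℓ := continuous_const.add (continuous_id.smul continuous_const)
  have hℓ0 : ℓ 0 = a := by simp [ℓ]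
  have hℓ1 : ℓ 1 = b := by simp [ℓ]
  have hq0 : q ≠ 0 := by
    intro h
    have := hq 0
    rw [h, Polynomial.eval_zero] at this
    exact ha (hℓ0 ▸ this.symm)
  have hfin : {s : ℂ | q.IsRoot s}.Finite := Polynomial.finite_setOf_isRoot hq0
  have hpc : IsPathConnected {s : ℂ | q.IsRoot s}ᶜ :=
    hfin.countable.isPathConnected_compl_of_one_lt_rank
      (by rw [Complex.rank_real_complex]; exact Cardinal.one_lt_two)
  have hmem : ∀ s, s ∈ {s : ℂ | q.IsRoot s}ᶜ ↔ eval (ℓ s) g ≠ 0 := fun s ↦ by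
    simp only [Set.mem_compl_iff, Set.mem_setOf_eq, Polynomial.IsRoot.def, hq s]
    rfl
  have h0 : (0 : ℂ) ∈ {s : ℂ | q.IsRoot s}ᶜ := (hmem 0).mpr (hℓ0 ▸ ha)
  have h1 : (1 : ℂ) ∈ {s : ℂ | q.IsRoot s}ᶜ := (hmem 1).mpr (hℓ1 ▸ hb)
  have hJ := ((hpc.joinedIn 0 h0 1 h1).map hℓ).mono (V := {z : Fin n → ℂ | eval z g ≠ 0}) (by
    rintro _ ⟨s, hs, rfl⟩
    exact (hmem s).mp hs)
  rwa [hℓ0, hℓ1] at hJ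

/-- Hence `ℂⁿ ∖ Z(g)` is connected for `g ≠ 0`. [Shafarevich1994 VII §2.1 Lemma 7.2, special case]
[folklore] -/
theorem isConnected_setOf_eval_ne_zero {n : ℕ} {g : MvPolynomial (Fin n) ℂ} (hg : g ≠ 0) :
    IsConnected {z : Fin n → ℂ | eval z g ≠ 0} :=
  (isPathConnected_setOf_eval_ne_zero hg).isConnected

/-- `ℂⁿ ∖ Z(g)` is open. [folklore] -/
theorem isOpen_setOf_eval_ne_zero {n : ℕ} (g : MvPolynomial (Fin n) ℂ) :
    IsOpen {z : Fin n → ℂ | eval z g ≠ 0} :=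
  isOpen_ne_fun (MvPolynomial.continuous_eval g) continuous_const

end Literature.NumberTheory.Transcendental
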